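import Summits.RiemannHypothesis.RiemannHypothesis.Theses.RuelleBand
import Literature.Barriers.RiemannHypothesis.BohrDenseValuesProofs
import Literature.Barriers.RiemannHypothesis.BohrDenseValuesVoronin
import HarnessLib

/-!
# `ZetaWeakRecurrence` — negative-side calibration (refuter, stmt-RiemannHypothesis-18110)

An unconditional refutation of the crux `RuelleBand.ZetaWeakRecurrence` would disprove the Riemann
hypothesis: `¬ ZetaWeakRecurrence → ¬ RiemannHypothesis` (contrapositive of Bagchi's "⇒", tree-proved
from Voronin 1975). [cite: Steuding2007, Thm. 8.3]
-/

open Complex Set Metric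
open Literature.Barriers.RiemannHypothesis

namespace Summit.RiemannHypothesis.RiemannHypothesis.Theorems.ZetaWeakRecurrence.Negative

open Summit.RiemannHypothesis.RiemannHypothesis.Theses.RuelleBand

/-- Refuting weak shift-recurrence of `ζ` refutes RH (so no unconditional `¬ ZetaWeakRecurrence`
can be landed short of `¬ RH`). [cite: Steuding2007, Thm. 8.3] -/
theorem not_riemannHypothesis_of_not_zetaWeakRecurrence (h : ¬ ZetaWeakRecurrence) :
    ¬ _root_.RiemannHypothesis := by
  intro hRH
  apply h
  intro z r hr hrmin ε hε T
  have hz1 : 1 / 2 < z.re := by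
    have := hrmin.trans_le (min_le_left _ _); linarith
  have hz2 : z.re < 1 := by
    have := hrmin.trans_le (min_le_right _ _); linarith
  have hS := (riemannHypothesis_iff_strongRecurrence_of_Voronin Voronin1975_universality_holds).1 hRH
  obtain ⟨τ, hτ, hTτ⟩ := (hS ε hε z hz1 hz2 r hr hrmin).exists_gt T
  exact ⟨τ, hTτ.le, hτ⟩

end Summit.RiemannHypothesis.RiemannHypothesis.Theorems.ZetaWeakRecurrence.Negative
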